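import Summits.ResolutionOfSingularities.ResolutionOfSingularities.Theorems.WeightedInvariantIotaOrderGenericEquimultiplicity
import Summits.ResolutionOfSingularities.ResolutionOfSingularities.Theorems.WeightedInvariantStratumIffOfStrat
import Summits.ResolutionOfSingularities.ResolutionOfSingularities.Theorems.WeightedInvariantIotaOrderStratDimTwo
import Literature.AlgebraicGeometry.Resolution.OrderSemicontinuity
import HarnessLib

/-!
# Upper semicontinuity of the order function on the regular locus, IN IDEAL FORM (`husc`), and the STRATUM IFF of
# (open″) for `ι = iotaOrd` made unconditional (door `HypersurfaceCentreConstruction`, stmt-ResolutionOfSingularities-19897 ·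
# ORDER (o24-O), lead res-type-005; res-L1-w43-plan-1 ASSIGNMENT 2026-08-27T08:16:45Z)

Topic: `Summits/ResolutionOfSingularities/ResolutionOfSingularities/Theorems`. Helper for the door item
`HypersurfaceCentreConstruction` (stmt-ResolutionOfSingularities-19897, route `WeightedInvariant`). res-type-073's
`StratumIff.stratumIff_iotaOrd_of_strat` (`…StratumIffOfStrat`, p511396) derives the STRATUM IFF of the ∀-model open presentation
clause (open″) for the order function from the (strat)+(adm) conjuncts of the canonical game clause, leaving ONE input open:
`husc` — upper semicontinuity of `𝔮 ↦ ord_{A_𝔮} F` along the regular basic open `D(h₀) ∋ 𝔪` IN IDEAL FORM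
(`{𝔮 : n ≤ ord_𝔮 F} ∩ D(h₀) = V(I_n) ∩ D(h₀)`). This file DISCHARGES `husc` at the ring level — no schemes, no Hasse derivatives —
from the generic bound of (o23c) (`…IotaOrderGenericEquimultiplicity`, p513129), and records the resulting unconditional stratum iff,
in particular at every position of Krull dimension ≤ 2 (res-type-073's `IotaOrderStrat.strat_adm_iotaOrd_of_ringKrullDim_le_two`,
p509553). [OURS · L1 W4.3] Replaces the role of NO printed item; NOT a statement of the manuscript
[claim: Hironaka2017, status: under-review]. AI work, weaker than expert review.

## What is proved (def-free)

Let `k` be a perfect field, `A` a finitely generated `k`-algebra, `h₀ ∈ A` with `A_𝔮` regular for every prime `𝔮 ∌ h₀`, `F ∈ A`.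

* `isClosed_setOf_mem_or_le_iotaOrd` — for every `n`, the set `V(h₀) ∪ {𝔮 | n ≤ ord_{A_𝔮} F}` is CLOSED in `Spec A`: it is stable
  under specialization ((c7), res-type-073's `StratumIff.iotaOrd_localization_mono` on the regular `D(h₀)`), and a point `ξ` of
  its closure off it would have `ord_ξ F = m < n` and, by the GENERIC BOUND `exists_not_mem_forall_mem_pow_and_not_mem_pow`
  (p513129), a basic open `D(h) ∋ ξ` on which the order along `V(ξ)` stays `≤ m` — contradicting the Noetherian-sober closure
  lemma `Resolution.exists_specializes_mem_closure_inter` (Cossart–Piltant 2008, proof of Prop. 4.2, as in the tree's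
  `OrderSemicontinuity.isClosed_setOf_le_idealOrder_of_isJ2_general`, here for `Spec A` directly).
* **`husc_iotaOrd`** — hence `∀ n, ∃ I : Ideal A, ∀ 𝔮 ∌ h₀ prime, ((n : Ordinal) ≤ iotaOrd (A_𝔮) F ↔ I ≤ 𝔮)`: the literal
  `husc` binder of `stratumIff_iotaOrd_of_strat`.
* **`stratumIff_iotaOrd`** — `stratumIff_iotaOrd_of_strat` with `husc` and the regular basic open discharged: for `A_𝔪` regular,
  `F ≠ 0` in `A_𝔪`, and (strat)+(adm) for `iotaOrd` at `S = A_𝔪` with centre `P`, there is `h ∉ 𝔪` with, on `D(h)`: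
  `P ∩ A ⊆ 𝔮 ↔ (F ∈ 𝔪_{A_𝔮}² ∧ ord_𝔮 F = ord_𝔪 F)` — ANY dimension.
* **`stratumIff_iotaOrd_of_ringKrullDim_le_two`** — at a position of Krull dimension ≤ 2 the (strat)+(adm) inputs are
  res-type-073's theorem, so the stratum iff of (open″)↾≤2 for `ι = iotaOrd` holds outright (centre `P` = `(g)` at monomial
  type, `= 𝔪_{A_𝔪}` otherwise): the ι-side of ORDER (o24-O) in all three cases at once; the J-presentation (case (ii)
  res-type-025, case (iii) at `𝔮 = 𝔪` only) and the `U`-bridge `(∀ i, U i ∈ 𝔮) ↔ P ∩ A ⊆ 𝔮` are the assembly's business.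

## References

* V. Cossart, O. Piltant, J. Algebra 320 (2008), proof of Prop. 4.2 (u.s.c. of the order). [cite: CossartPiltant2008, Prop. 4.2 (proof)]
* H. Matsumura, *Commutative Ring Theory*, §30 Cor. to Thm. 30.5 (regular locus open). [Matsumura1987]
-/

noncomputable section

open IsLocalRing Literature.AlgebraicGeometry.Resolution
open Summit.ResolutionOfSingularities.ResolutionOfSingularities.Cruxes.HypersurfaceCentreConstruction.LocalEngine

set_option linter.dupNamespace false -- mandated namespace of this single-conjunct summit

namespace Summit.ResolutionOfSingularities.ResolutionOfSingularities.Theorems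

namespace GenericEquimultiplicity

variable {A : Type} [CommRing A]

/-! ## Upper semicontinuity of the order on the regular basic open `D(h₀)` -/

/-- **The superlevel sets of the order are closed on the regular locus** (ring level): `k` perfect, `A` of finite type over `k`,
`A_𝔮` regular for every prime `𝔮 ∌ h₀`; then for every `F ∈ A` and `n : ℕ` the set `V(h₀) ∪ {𝔮 | F ∈ 𝔪_{A_𝔮}ⁿ}` is closed in
`Spec A` (stable under specialization by (c7); closed by the generic bound of p513129 and the Noetherian-sober closure lemma).
[OURS · L1 W4.3 · (o24-O)] [cite: CossartPiltant2008, Prop. 4.2 (proof)] -/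
theorem isClosed_setOf_mem_or_mem_pow (k : Type) [Field k] [PerfectField k] [Algebra k A] [Algebra.FiniteType k A]
    {h₀ : A} (hreg : ∀ (𝔮 : Ideal A) [𝔮.IsPrime], h₀ ∉ 𝔮 → IsRegularLocalRing (Localization.AtPrime 𝔮)) (F : A) (n : ℕ) :
    IsClosed {x : PrimeSpectrum A | h₀ ∈ x.asIdeal ∨
      algebraMap A (Localization.AtPrime x.asIdeal) F ∈ maximalIdeal (Localization.AtPrime x.asIdeal) ^ n} := by
  classical
  haveI : IsNoetherianRing A := Algebra.FiniteType.isNoetherianRing k A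
  set S := {x : PrimeSpectrum A | h₀ ∈ x.asIdeal ∨
      algebraMap A (Localization.AtPrime x.asIdeal) F ∈ maximalIdeal (Localization.AtPrime x.asIdeal) ^ n} with hSdef
  -- stable under specialization
  have hstab : ∀ x y : PrimeSpectrum A, x ⤳ y → x ∈ S → y ∈ S := by
    intro x y hxy hx
    have hle : x.asIdeal ≤ y.asIdeal := (PrimeSpectrum.le_iff_specializes x y).mpr hxy
    by_cases hy : h₀ ∈ y.asIdeal
    · exact Or.inl hy
    rcases hx with hx | hx
    · exact absurd (hle hx) hy
    · right
      rw [← natCast_le_iotaOrd_iff] at hx ⊢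
      exact hx.trans (StratumIff.iotaOrd_localization_mono F x.asIdeal y.asIdeal hle (hreg _ hy))
  refine isClosed_of_closure_subset fun y hy => ?_
  obtain ⟨ξ, hξy, hξ⟩ := exists_specializes_mem_closure_inter S hy
  suffices hξS : ξ ∈ S from hstab ξ y hξy hξS
  by_contra hξS
  have hh₀ξ : h₀ ∉ ξ.asIdeal := fun h => hξS (Or.inl h)
  have hFn : algebraMap A (Localization.AtPrime ξ.asIdeal) F ∉
      maximalIdeal (Localization.AtPrime ξ.asIdeal) ^ n := fun h => hξS (Or.inr h)
  haveI hregξ : IsRegularLocalRing (Localization.AtPrime ξ.asIdeal) := hreg _ hh₀ξ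
  -- the order of `F` at `ξ` is a natural number `m < n`
  have hF0 : algebraMap A (Localization.AtPrime ξ.asIdeal) F ≠ 0 := fun h => hFn (by rw [h]; exact zero_mem _)
  obtain ⟨m, hm⟩ := Ordinal.lt_omega0.mp (iotaOrd_lt_omega0_of_ne_zero (Localization.AtPrime ξ.asIdeal) hF0)
  obtain ⟨hFm, hFm1⟩ := (iotaOrd_eq_natCast_iff (Localization.AtPrime ξ.asIdeal) _ m).mp hm
  have hmn : m + 1 ≤ n := by
    by_contra hlt
    exact hFn (Ideal.pow_le_pow_right (by omega) hFm)
  -- the generic bound along `V(ξ)`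
  obtain ⟨h, hhξ, hh⟩ := exists_not_mem_forall_mem_pow_and_not_mem_pow k ξ.asIdeal hregξ hFm hFm1
  -- `S ∩ closure {ξ} ⊆ V(h h₀)`, a closed set missing `ξ`
  have hsub : S ∩ closure {ξ} ⊆ PrimeSpectrum.zeroLocus {h * h₀} := by
    rintro z ⟨hzS, hzξ⟩
    rw [PrimeSpectrum.mem_zeroLocus, Set.singleton_subset_iff, SetLike.mem_coe]
    have hξz : ξ.asIdeal ≤ z.asIdeal :=
      (PrimeSpectrum.le_iff_specializes ξ z).mpr (specializes_iff_mem_closure.mpr hzξ)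
    by_cases hz : h₀ ∈ z.asIdeal
    · exact Ideal.mul_mem_left _ _ hz
    rcases hzS with hz' | hz'
    · exact absurd hz' hz
    · have hhz : h ∈ z.asIdeal := by
        by_contra hhz
        exact (hh z.asIdeal hξz hhz).2 (Ideal.pow_le_pow_right hmn hz')
      exact Ideal.mul_mem_right _ _ hhz
  have hξV : ξ ∈ PrimeSpectrum.zeroLocus {h * h₀} :=
    ((PrimeSpectrum.isClosed_zeroLocus _).closure_subset_iff.mpr hsub) hξ
  rw [PrimeSpectrum.mem_zeroLocus, Set.singleton_subset_iff, SetLike.mem_coe] at hξV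
  rcases Ideal.IsPrime.mem_or_mem inferInstance hξV with h' | h'
  · exact hhξ h'
  · exact hh₀ξ h'

/-- **`husc` for the order function** (the literal open input of res-type-073's `StratumIff.stratumIff_iotaOrd_of_strat`):
upper semicontinuity of `𝔮 ↦ iotaOrd (A_𝔮) F` along the regular basic open `D(h₀)` IN IDEAL FORM — for every `n` there is an
ideal `I` with `n ≤ ord_𝔮 F ↔ I ⊆ 𝔮` for all primes `𝔮 ∌ h₀`. [OURS · L1 W4.3 · (o24-O)] [cite: CossartPiltant2008, Prop. 4.2 (proof)] -/
theorem husc_iotaOrd (k : Type) [Field k] [PerfectField k] [Algebra k A] [Algebra.FiniteType k A]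
    {h₀ : A} (hreg : ∀ (𝔮 : Ideal A) [𝔮.IsPrime], h₀ ∉ 𝔮 → IsRegularLocalRing (Localization.AtPrime 𝔮)) (F : A) (n : ℕ) :
    ∃ I : Ideal A, ∀ (𝔮 : Ideal A) [𝔮.IsPrime], h₀ ∉ 𝔮 →
      ((n : Ordinal) ≤ iotaOrd (Localization.AtPrime 𝔮) (algebraMap A (Localization.AtPrime 𝔮) F) ↔ I ≤ 𝔮) := by
  obtain ⟨I, hI⟩ := (PrimeSpectrum.isClosed_iff_zeroLocus_ideal _).mp (isClosed_setOf_mem_or_mem_pow k hreg F n)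
  refine ⟨I, fun 𝔮 _ h𝔮 => ?_⟩
  have hmem := Set.ext_iff.mp hI ⟨𝔮, inferInstance⟩
  rw [Set.mem_setOf_eq, PrimeSpectrum.mem_zeroLocus] at hmem
  rw [natCast_le_iotaOrd_iff]
  constructor
  · intro h
    exact fun x hx => hmem.mp (Or.inr h) hx
  · intro h
    rcases hmem.mpr (fun x hx => h hx) with h' | h'
    · exact absurd h' h𝔮
    · exact h'

/-! ## The stratum iff of (open″) for `ι = iotaOrd`, unconditional -/

/-- **STRATUM-EXACTNESS FOR THE ORDER FUNCTION, unconditional** (res-type-073's `StratumIff.stratumIff_iotaOrd_of_strat` with its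
`husc` input discharged by `husc_iotaOrd` and the regular basic open supplied by `exists_not_mem_forall_isRegularLocalRing`):
`k` perfect, `A` of finite type over `k`, `𝔪` a prime with `A_𝔪` regular (ANY dimension), `F ≠ 0` in `A_𝔪`; given the
(strat)+(adm) conjuncts of `CanonicalGameClause` for `ι = iotaOrd` at `S = A_𝔪` with centre `P`, there is `h ∉ 𝔪` such that for
every prime `𝔮 ∌ h`: `P ∩ A ⊆ 𝔮 ↔ (F ∈ 𝔪_{A_𝔮}² ∧ ord_𝔮 F = ord_𝔪 F)`. [OURS · L1 W4.3 · (o24-O)]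
[cite: CossartPiltant2008, Prop. 4.2 (proof)] -/
theorem stratumIff_iotaOrd (k : Type) [Field k] [PerfectField k] [Algebra k A] [Algebra.FiniteType k A]
    (𝔪 : Ideal A) [𝔪.IsPrime] (F : A) (h𝔪 : IsRegularLocalRing (Localization.AtPrime 𝔪))
    (hF0 : algebraMap A (Localization.AtPrime 𝔪) F ≠ 0)
    (P : Ideal (Localization.AtPrime 𝔪)) [P.IsPrime]
    (hstrat : ∀ (𝔭 : Ideal (Localization.AtPrime 𝔪)) [𝔭.IsPrime],
      algebraMap A (Localization.AtPrime 𝔪) F ∈ 𝔭 →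
        (iotaOrd (Localization.AtPrime 𝔭) (algebraMap (Localization.AtPrime 𝔪) (Localization.AtPrime 𝔭)
            (algebraMap A (Localization.AtPrime 𝔪) F)) =
          iotaOrd (Localization.AtPrime 𝔪) (algebraMap A (Localization.AtPrime 𝔪) F) ↔ P ≤ 𝔭))
    (hadm : ∀ (Q : Ideal (Localization.AtPrime 𝔪)) [Q.IsPrime], P ≤ Q →
      algebraMap (Localization.AtPrime 𝔪) (Localization.AtPrime Q) (algebraMap A (Localization.AtPrime 𝔪) F) ∈
        maximalIdeal (Localization.AtPrime Q) ^ 2) :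
    ∃ h : A, h ∉ 𝔪 ∧ ∀ (𝔮 : Ideal A) [𝔮.IsPrime], h ∉ 𝔮 →
      (P.comap (algebraMap A (Localization.AtPrime 𝔪)) ≤ 𝔮 ↔
        (algebraMap A (Localization.AtPrime 𝔮) F ∈ maximalIdeal (Localization.AtPrime 𝔮) ^ 2 ∧
          iotaOrd (Localization.AtPrime 𝔮) (algebraMap A (Localization.AtPrime 𝔮) F) =
            iotaOrd (Localization.AtPrime 𝔪) (algebraMap A (Localization.AtPrime 𝔪) F))) := by
  haveI : IsNoetherianRing A := Algebra.FiniteType.isNoetherianRing k A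
  obtain ⟨h₀, hh₀, hreg⟩ := exists_not_mem_forall_isRegularLocalRing k 𝔪 h𝔪
  exact StratumIff.stratumIff_iotaOrd_of_strat 𝔪 F hF0 h₀ hh₀ hreg (fun n => husc_iotaOrd k hreg F n) P hstrat hadm

/-- **The stratum iff of (open″)↾≤2 for `ι = iotaOrd`, all cases at once**: at a position `𝔪` with `A_𝔪` regular of Krull
dimension ≤ 2 and `0 ≠ F ∈ 𝔪² A_𝔪` (`k` perfect, `A` of finite type), the (strat)+(adm) inputs are res-type-073's
`IotaOrderStrat.strat_adm_iotaOrd_of_ringKrullDim_le_two` (centre `P = (g)` at monomial type, `= 𝔪 A_𝔪` otherwise), so there are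
a prime `P` of `A_𝔪` with `A_𝔪 ⧸ P` regular, `F ∈ P`, and `h ∉ 𝔪` with `P ∩ A ⊆ 𝔮 ↔ (F ∈ 𝔪_{A_𝔮}² ∧ ord_𝔮 F = ord_𝔪 F)` on `D(h)`.
The ι-side of ORDER (o24-O). [OURS · L1 W4.3 · (o24-O)] [cite: CossartPiltant2008, Prop. 4.2 (proof)] -/
theorem stratumIff_iotaOrd_of_ringKrullDim_le_two (k : Type) [Field k] [PerfectField k] [Algebra k A]
    [Algebra.FiniteType k A] (𝔪 : Ideal A) [𝔪.IsPrime] (F : A) (h𝔪 : IsRegularLocalRing (Localization.AtPrime 𝔪))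
    (hdim : ringKrullDim (Localization.AtPrime 𝔪) ≤ 2)
    (hF0 : algebraMap A (Localization.AtPrime 𝔪) F ≠ 0)
    (hF2 : algebraMap A (Localization.AtPrime 𝔪) F ∈ maximalIdeal (Localization.AtPrime 𝔪) ^ 2) :
    ∃ (P : Ideal (Localization.AtPrime 𝔪)), P.IsPrime ∧ IsRegularLocalRing (Localization.AtPrime 𝔪 ⧸ P) ∧
      algebraMap A (Localization.AtPrime 𝔪) F ∈ P ∧
      (∀ (Q : Ideal (Localization.AtPrime 𝔪)) [Q.IsPrime], P ≤ Q →
        algebraMap (Localization.AtPrime 𝔪) (Localization.AtPrime Q) (algebraMap A (Localization.AtPrime 𝔪) F) ∈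
          maximalIdeal (Localization.AtPrime Q) ^ 2) ∧
      ∃ h : A, h ∉ 𝔪 ∧ ∀ (𝔮 : Ideal A) [𝔮.IsPrime], h ∉ 𝔮 →
        (P.comap (algebraMap A (Localization.AtPrime 𝔪)) ≤ 𝔮 ↔
          (algebraMap A (Localization.AtPrime 𝔮) F ∈ maximalIdeal (Localization.AtPrime 𝔮) ^ 2 ∧
            iotaOrd (Localization.AtPrime 𝔮) (algebraMap A (Localization.AtPrime 𝔮) F) =
              iotaOrd (Localization.AtPrime 𝔪) (algebraMap A (Localization.AtPrime 𝔪) F))) := by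
  haveI := h𝔪
  obtain ⟨P, hP, hreg, hFP, hstrat, hadm⟩ :=
    IotaOrderStrat.strat_adm_iotaOrd_of_ringKrullDim_le_two (S := Localization.AtPrime 𝔪) hdim hF0 hF2
  haveI := hP
  obtain ⟨h, hh, hiff⟩ := stratumIff_iotaOrd k 𝔪 F h𝔪 hF0 P (fun 𝔭 _ hF𝔭 => hstrat 𝔭 hF𝔭) (fun Q _ hQ => hadm Q hQ)
  exact ⟨P, hP, hreg, hFP, fun Q _ hQ => hadm Q hQ, h, hh, fun 𝔮 _ h𝔮 => hiff 𝔮 h𝔮⟩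

end GenericEquimultiplicity

end Summit.ResolutionOfSingularities.ResolutionOfSingularities.Theorems

end
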